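import Summits.QuantumFields.YangMills.Theorems.BalabanUVNodesN21LowCentreEndAtSUNBlockChartRecord

/-!
# N21 (NE7c) · THE [LF-II] §1-LETTERS END ON THE EXPONENTIAL `SU(N)` BLOCK CHART, III: THE HAAR JACOBIAN RIDES IN THE
# REMAINDER — file 10's density presentation `hdens` PRODUCED from a presentation of the DRESSED block weight alone, the
# exponential chart's Jacobian `∏_b κ_N·det T_{z_b}` being a LOG-CONCAVE, BOUNDED-BELOW weight on the window (pub-balaban BY NAME)

Width seat pub-ymgap-dag-n21-w1 (g2; director-ym №197 ∕ HUMAN RULING D-0149), node N21 = NE7c (single-run shell-weight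
bound, NOT PRINTED in [Bałaban 1983–89], NOT proved), lane K3⁷ `SpineGivenEndpointR13SepCoPH` (stmt-QuantumFields-20544,
`--kind proof --supports … --as helper`).  Eleventh file of the seat's item-1 chain; companion of files 9∕10
(`…LowCentreEndAtSUNBlockChart` ∕ `…Record`).  Consumes BY NAME: file 10 ★★★ `fibreAC_of_sect1Letters_expChartSU`; pub-balaban's
`ShellMeasureLogConcaveDetSUN.log_det_duhT_convexComb_ge` (Davis–Schur: `log det T_v` CONCAVE on the closed `π`-ball),
`ShellMeasureExpHaarClosedBallSUN.det_duhT_pos_of_norm_le_pi`, `ShellMeasureExpDuhamelDetSUN.det_eq_prod_sinc` ∕ `det_mem_Icc`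
(at `T_v`, `genSU_duhT_eq_integral`), `ShellMeasureExpDuhamelSUN.duhT_zero`, `ShellMeasureExpJacobianSUN.exists_conjDiag` ∕ `abs_eigen_le_norm`,
`ShellMeasureScalingSU2.sinc_le_sinc_of_le_of_le_pi`, `ShellMeasureLogConcaveJacobianSUN.jacM_eq_ofReal_det`,
`ShellMeasureLogConcaveSUN.chartWeightSU_expJac_ae_eq` (the a.e. swap `expJacSU ↦ jacM = det T`).  THEOREMS ONLY: 0 `def`,
0 `sorry`; count-neutral.

WHY.  File 10's ★★★ asks ONE density presentation `hdens : 1_{‖z‖≤S}·∏_b κ_N·expJacSU(z_b) · R(expFibreChartSU b c z) =ᵐ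
𝟙_{U<θ}∩C·𝟙_K·e^{−φ}` with `K ∋ 0` convex and `φ` convex carrying the (1.2) expansion.  The JACOBIAN factor is NOT the
consumer's business: pub-balaban proved that `v ↦ log det T_v` is concave on `‖v‖ ≤ π` and `det T_v > 0` there; so
`Ψ(z) := Σ_b −log det T_{z_b}` is CONVEX on the window `‖z‖ ≤ S ≤ π`, vanishes at the centre (`T_0 = id`), is `≥ 0`
(`det T ≤ 1`) and — from `det T_v = ∏_{i<j} sinc²((θ_j−θ_i)∕2)`, `|θ_j − θ_i| ≤ 2‖v‖`, `sinc` non-increasing on `[0, π]` — is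
at most `W_J := #b·(N·N)·(−2·log sinc S)` on the window (`S < π`).  Hence, GIVEN a presentation of the dressed block weight
read in the chart ON THE WINDOW, `R(expFibreChartSU b c z) = 𝟙_{U<θ}∩C·𝟙_{K₀}·e^{−A(z)}` with `K₀ ∋ 0` convex and `A` convex
carrying the (1.2) expansion `A = A(0) + ½Q + lin + Vt`, file 10's `hdens` HOLDS with `K := K₀ ∩ B̄_S`,
`φ := A + Ψ − #b·log κ_N`, and the Jacobian's `Ψ` absorbed into the remainder: `Vt′ := Vt + Ψ`, `|Vt′| ≤ W_V + W_J`.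

WHAT IS PROVED HERE ([folklore] over pub-balaban BY NAME + [textbook]; companion `…JacobianEnd` carries §4 ★★, the END
with the Jacobian in the remainder).
* §1 ONE BOND: `convexOn_negLogDet` (`v ↦ −log det T_v` convex on `B̄_S`, `S ≤ π`), `negLogDet_nonneg`, `negLogDet_zero`,
  `det_duhT_ge_pow_sinc` (`det T_v ≥ (sinc S)^{2·N·N}` for `‖v‖ ≤ S ≤ π`), `negLogDet_le` (`−log det T_v ≤ (N·N)·(−2 log sinc S)`, `S < π`).
* §2 THE BLOCK: `convexOn_blockNegLogDet`, `blockNegLogDet_nonneg`, `blockNegLogDet_zero`, `blockNegLogDet_le`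
  (`Ψ ≤ W_J` on `B̄_S`), `chartWeightSU_jacM_eq_indicator_exp` (ON EVERY POINT: `1_{‖z‖≤S}·∏_b κ_N·det T_{z_b} =
  1_{B̄_S}(z)·κ_N^{#b}·e^{−Ψ(z)}`), `chartWeightSU_expJac_ae_eq_indicator_exp` (the weight of record, `volume`-a.e.).
* §3 ★ `hdens_of_dressedPresentation`: file 10's `hdens` from the dressed presentation on the window.

HONEST FRAMING.  [folklore]∕[textbook] + composition BY NAME; the Haar Jacobian of the exponential chart is DISCHARGED here
(pub-balaban's theorems, credited; nothing retyped); the located letters that REMAIN hypotheses are `hlaw`, the dressed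
presentation `hR` (convexity of the (1.2) exponent on the chart — desk (t4) — with its rows' identification with the N21
slot's block action), and the statistic's binders; nothing of Bałaban's asserted; NE7c NOT PRINTED ∕ NOT proved; N21 NOT
discharged; K3⁷ NOT claimed; counts unmoved (typed 28∕28 · discharged 5∕27); never a count claim; one finite 𝕋⁴ at fixed ε —
R4 would close only the conditional finite-𝕋⁴ rung `BalabanLadder.UV`, NOT the Yang–Mills mass gap (Clay); nothing about ℝ⁴ ∕ OS.
-/

set_option autoImplicit false

noncomputable section

open MeasureTheory Set Function Finset Metric
open scoped ENNReal BigOperators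

namespace Summit.QuantumFields.YangMills.Theorems.N21LowCentreEndAtSUNBlockChartJacobian

open Literature.MathematicalPhysics.QuantumFieldTheory.Balaban1983to89
open Literature.MathematicalPhysics.QuantumFieldTheory.Balaban1983to89.T4Continuum
open Literature.MathematicalPhysics.QuantumFieldTheory.Balaban1983to89.Node00 hiding dimSU
open Summit.QuantumFields.BalabanUV.T4Continuum
open Summit.QuantumFields.BalabanUV.T4Continuum.ShellMeasureExpChartSUN
  (SUN ChartSU BlockChartSU dimSU expFibreChartSU chartWeightSU chartWeightSU_eq_prod_indicator norm_apply_le_of_mem_closedBall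
    measurable_chartWeightSU)
open Summit.QuantumFields.BalabanUV.T4Continuum.ShellMeasureExpJacobianSUN (expJacWeightSU exists_conjDiag abs_eigen_le_norm sinc_abs)
open Summit.QuantumFields.BalabanUV.T4Continuum.ShellMeasureExpHaarAreaSUN (jacM measurable_jacM kappaSU kappaSU_ne_top kappaSU_ne_zero)
open Summit.QuantumFields.BalabanUV.T4Continuum.ShellMeasureExpDuhamelSUN (duhT duhT_zero genSU_duhT_eq_integral)
open Summit.QuantumFields.BalabanUV.T4Continuum.ShellMeasureExpDuhamelDetSUN (det_eq_prod_sinc det_mem_Icc)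
open Summit.QuantumFields.BalabanUV.T4Continuum.ShellMeasureExpHaarClosedBallSUN (det_duhT_pos_of_norm_le_pi)
open Summit.QuantumFields.BalabanUV.T4Continuum.ShellMeasureLogConcaveDetSUN (log_det_duhT_convexComb_ge)
open Summit.QuantumFields.BalabanUV.T4Continuum.ShellMeasureScalingSU2 (sinc_le_sinc_of_le_of_le_pi)
open Summit.QuantumFields.BalabanUV.T4Continuum.ShellMeasureLogConcaveJacobianSUN (jacM_eq_ofReal_det)
open Summit.QuantumFields.BalabanUV.T4Continuum.ShellMeasureLogConcaveSUN (chartWeightSU_expJac_ae_eq)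

/-! ## §1  One bond: `v ↦ −log det T_v` is convex on the window, `≥ 0`, `0` at the centre, and bounded by `−2·N·N·log sinc S` -/

section OneBond

variable {N : ℕ}

/-- **`v ↦ −log det T_v` IS CONVEX ON EVERY WINDOW `‖v‖ ≤ S ≤ π`** (pub-balaban's Davis–Schur concavity
`log_det_duhT_convexComb_ge`, sign flipped). [folklore] -/
theorem convexOn_negLogDet {S : ℝ} (hS : S ≤ Real.pi) :
    ConvexOn ℝ (closedBall (0 : ChartSU N) S)
      fun v => -Real.log (LinearMap.det (duhT v : ChartSU N →ₗ[ℝ] ChartSU N)) := by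
  refine ⟨convex_closedBall _ _, fun x hx y hy a c ha hc hac => ?_⟩
  have hxπ : ‖x‖ ≤ Real.pi := (mem_closedBall_zero_iff.mp hx).trans hS
  have hyπ : ‖y‖ ≤ Real.pi := (mem_closedBall_zero_iff.mp hy).trans hS
  have h := log_det_duhT_convexComb_ge hxπ hyπ ha hc hac
  simp only [smul_eq_mul]
  linarith

/-- `0 ≤ −log det T_v` (`det T_v ≤ 1`). [folklore] -/
theorem negLogDet_nonneg (v : ChartSU N) : 0 ≤ -Real.log (LinearMap.det (duhT v : ChartSU N →ₗ[ℝ] ChartSU N)) := by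
  have h := det_mem_Icc _ (genSU_duhT_eq_integral v)
  have : Real.log (LinearMap.det (duhT v : ChartSU N →ₗ[ℝ] ChartSU N)) ≤ 0 := Real.log_nonpos h.1 h.2
  linarith

/-- `−log det T_0 = 0` (`T_0 = id`). [folklore] -/
theorem negLogDet_zero : -Real.log (LinearMap.det (duhT (0 : ChartSU N) : ChartSU N →ₗ[ℝ] ChartSU N)) = 0 := by
  rw [duhT_zero, ContinuousLinearMap.coe_id, LinearMap.det_id, Real.log_one, neg_zero]

/-- **`det T_v ≥ (sinc S)^{2·N·N}` ON THE WINDOW `‖v‖ ≤ S ≤ π`**: `det T_v = ∏_i ∏_{j>i} sinc²((θ_j−θ_i)∕2)` in an eigenframe,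
`|θ_j − θ_i|∕2 ≤ ‖v‖ ≤ S`, `sinc` non-increasing and `≤ 1` on `[0, π]` (so missing factors only help). [folklore] -/
theorem det_duhT_ge_pow_sinc {S : ℝ} (hSπ : S ≤ Real.pi) {v : ChartSU N} (hv : ‖v‖ ≤ S) :
    Real.sinc S ^ (2 * (N * N)) ≤ LinearMap.det (duhT v : ChartSU N →ₗ[ℝ] ChartSU N) := by
  have hS0 : 0 ≤ S := (norm_nonneg v).trans hv
  obtain ⟨U, θ, h⟩ := exists_conjDiag v
  rw [det_eq_prod_sinc h _ (genSU_duhT_eq_integral v)]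
  have hs0 : 0 ≤ Real.sinc S := (sinc_le_sinc_of_le_of_le_pi le_rfl hS0 hSπ).1
  have hs1 : Real.sinc S ≤ 1 := by
    have h1 := (sinc_le_sinc_of_le_of_le_pi le_rfl hS0 hSπ).2
    rwa [Real.sinc_zero] at h1
  -- each factor: `sinc S ^ 2 ≤ sinc((θ_j−θ_i)/2) ^ 2`
  have hfac : ∀ i j : Fin N, Real.sinc S ^ 2 ≤ Real.sinc ((θ j - θ i) / 2) ^ 2 := fun i j => by
    have hle : |(θ j - θ i) / 2| ≤ S := by
      rw [abs_div, abs_two]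
      have h2 : |θ j - θ i| ≤ ‖v‖ + ‖v‖ :=
        (abs_sub _ _).trans (add_le_add (abs_eigen_le_norm h j) (abs_eigen_le_norm h i))
      have : |θ j - θ i| / 2 ≤ ‖v‖ := by linarith
      exact this.trans hv
    have hmono := (sinc_le_sinc_of_le_of_le_pi (abs_nonneg _) hle hSπ).2
    rw [sinc_abs] at hmono
    exact pow_le_pow_left₀ hs0 hmono 2
  -- inner products: `(sinc S ^ 2) ^ N ≤ ∏_{j > i} sinc(...)^2` (at most `N` factors, each `≤ 1` would only be dropped)
  have hinner : ∀ i : Fin N, (Real.sinc S ^ 2) ^ N ≤ ∏ j ∈ Finset.Ioi i, Real.sinc ((θ j - θ i) / 2) ^ 2 := fun i => by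
    calc (Real.sinc S ^ 2) ^ N ≤ (Real.sinc S ^ 2) ^ (Finset.Ioi i).card := by
          refine pow_le_pow_of_le_one (sq_nonneg _) (pow_le_one₀ hs0 hs1) ?_
          exact (Finset.card_le_univ _).trans (Fintype.card_fin N).le
      _ = ∏ _j ∈ Finset.Ioi i, Real.sinc S ^ 2 := (Finset.prod_const _).symm
      _ ≤ ∏ j ∈ Finset.Ioi i, Real.sinc ((θ j - θ i) / 2) ^ 2 :=
          Finset.prod_le_prod (fun _ _ => sq_nonneg _) fun j _ => hfac i j
  calc Real.sinc S ^ (2 * (N * N)) = ∏ _i : Fin N, (Real.sinc S ^ 2) ^ N := by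
        rw [Finset.prod_const, Finset.card_univ, Fintype.card_fin, ← pow_mul, ← pow_mul]
    _ ≤ ∏ i : Fin N, ∏ j ∈ Finset.Ioi i, Real.sinc ((θ j - θ i) / 2) ^ 2 :=
        Finset.prod_le_prod (fun _ _ => pow_nonneg (sq_nonneg _) _) fun i _ => hinner i

/-- **`−log det T_v ≤ (N·N)·(−2·log sinc S)` ON THE WINDOW `‖v‖ ≤ S`, `0 ≤ S < π`** — the one-bond Jacobian letter `W_J∕#b`.
[folklore] -/
theorem negLogDet_le {S : ℝ} (hSπ : S < Real.pi) {v : ChartSU N} (hv : ‖v‖ ≤ S) :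
    -Real.log (LinearMap.det (duhT v : ChartSU N →ₗ[ℝ] ChartSU N)) ≤ (N * N : ℕ) * (-2 * Real.log (Real.sinc S)) := by
  have hS0 : 0 ≤ S := (norm_nonneg v).trans hv
  have hsS : 0 < Real.sinc S :=
    ShellMeasureLogConcaveJacobian.sinc_pos_of_mem_Ico ⟨hS0, hSπ⟩
  have hge := det_duhT_ge_pow_sinc hSπ.le hv
  have hpow : 0 < Real.sinc S ^ (2 * (N * N)) := pow_pos hsS _
  have hlog := Real.log_le_log hpow hge
  rw [Real.log_pow] at hlog
  push_cast at hlog ⊢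
  linarith

end OneBond

/-! ## §2  The block: `Ψ(z) = Σ_b −log det T_{z_b}` and the chart weight as `1_{B̄_S}·κ_N^{#b}·e^{−Ψ}` -/

section Block

variable {N : ℕ} {P : Params} {j : ℕ}

/-- **`Ψ` IS CONVEX ON THE BLOCK WINDOW `‖z‖ ≤ S ≤ π`** (a sum over the bonds of §1's convex one-bond letters composed with the
coordinate projections). [folklore] -/
theorem convexOn_blockNegLogDet (b : Finset (PBond P j)) {S : ℝ} (hS : S ≤ Real.pi) :
    ConvexOn ℝ (closedBall (0 : BlockChartSU N b) S)
      fun z => ∑ i, -Real.log (LinearMap.det (duhT (z i) : ChartSU N →ₗ[ℝ] ChartSU N)) := by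
  refine ⟨convex_closedBall _ _, fun x hx y hy a c ha hc hac => ?_⟩
  simp only [smul_eq_mul, Finset.mul_sum, ← Finset.sum_add_distrib]
  refine Finset.sum_le_sum fun i _ => ?_
  have hxi : x i ∈ closedBall (0 : ChartSU N) S := mem_closedBall_zero_iff.mpr (norm_apply_le_of_mem_closedBall b hx i)
  have hyi : y i ∈ closedBall (0 : ChartSU N) S := mem_closedBall_zero_iff.mpr (norm_apply_le_of_mem_closedBall b hy i)
  have h := (convexOn_negLogDet (N := N) hS).2 hxi hyi ha hc hac
  simp only [smul_eq_mul] at h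
  exact h

/-- `0 ≤ Ψ`. [folklore] -/
theorem blockNegLogDet_nonneg (b : Finset (PBond P j)) (z : BlockChartSU N b) :
    0 ≤ ∑ i, -Real.log (LinearMap.det (duhT (z i) : ChartSU N →ₗ[ℝ] ChartSU N)) :=
  Finset.sum_nonneg fun i _ => negLogDet_nonneg (z i)

/-- `Ψ(0) = 0`. [folklore] -/
theorem blockNegLogDet_zero (b : Finset (PBond P j)) :
    ∑ i, -Real.log (LinearMap.det (duhT ((0 : BlockChartSU N b) i) : ChartSU N →ₗ[ℝ] ChartSU N)) = 0 :=
  Finset.sum_eq_zero fun i _ => by rw [Pi.zero_apply]; exact negLogDet_zero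

/-- **`Ψ ≤ W_J := #b·(N·N)·(−2 log sinc S)` ON THE BLOCK WINDOW** (`0 ≤ S < π`). [folklore] -/
theorem blockNegLogDet_le (b : Finset (PBond P j)) {S : ℝ} (hSπ : S < Real.pi) {z : BlockChartSU N b}
    (hz : z ∈ closedBall (0 : BlockChartSU N b) S) :
    ∑ i, -Real.log (LinearMap.det (duhT (z i) : ChartSU N →ₗ[ℝ] ChartSU N)) ≤
      b.card * ((N * N : ℕ) * (-2 * Real.log (Real.sinc S))) := by
  calc ∑ i, -Real.log (LinearMap.det (duhT (z i) : ChartSU N →ₗ[ℝ] ChartSU N))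
      ≤ ∑ _i : ↥b, (N * N : ℕ) * (-2 * Real.log (Real.sinc S)) :=
        Finset.sum_le_sum fun i _ => negLogDet_le hSπ (norm_apply_le_of_mem_closedBall b hz i)
    _ = b.card * ((N * N : ℕ) * (-2 * Real.log (Real.sinc S))) := by
        rw [Finset.sum_const, Finset.card_univ, Fintype.card_coe, nsmul_eq_mul]

/-- **THE CONTINUOUS CHART WEIGHT AS A CUT LOG-CONCAVE DENSITY, AT EVERY POINT**:
`1_{‖z‖≤S}·∏_b κ_N·det T_{z_b} = 1_{B̄_S}(z)·κ_N^{#b}·e^{−Ψ(z)}` (`0 ≤ S ≤ π`; `det T > 0` on the window). [folklore] -/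
theorem chartWeightSU_jacM_eq_indicator_exp (b : Finset (PBond P j)) {S : ℝ} (hS : S ≤ Real.pi)
    (z : BlockChartSU N b) :
    chartWeightSU b S (fun v => kappaSU N * jacM v) z =
      (closedBall (0 : BlockChartSU N b) S).indicator
        (fun w => kappaSU N ^ b.card *
          ENNReal.ofReal (Real.exp (-∑ i, -Real.log (LinearMap.det (duhT (w i) : ChartSU N →ₗ[ℝ] ChartSU N))))) z := by
  unfold chartWeightSU
  by_cases hz : z ∈ closedBall (0 : BlockChartSU N b) S
  · rw [indicator_of_mem hz, indicator_of_mem hz, Finset.prod_mul_distrib, Finset.prod_const, Finset.card_univ,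
      Fintype.card_coe]
    congr 1
    have hpos : ∀ i, 0 < LinearMap.det (duhT (z i) : ChartSU N →ₗ[ℝ] ChartSU N) := fun i =>
      det_duhT_pos_of_norm_le_pi ((norm_apply_le_of_mem_closedBall b hz i).trans hS)
    rw [Finset.sum_neg_distrib, neg_neg, Real.exp_sum, ENNReal.ofReal_prod_of_nonneg fun i _ => (Real.exp_pos _).le]
    refine Finset.prod_congr rfl fun i _ => ?_
    rw [jacM_eq_ofReal_det, Real.exp_log (hpos i)]
  · rw [indicator_of_notMem hz, indicator_of_notMem hz]

/-- **THE CHART WEIGHT OF RECORD AS A CUT LOG-CONCAVE DENSITY, `volume`-ALMOST EVERYWHERE**: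
`1_{‖z‖≤S}·∏_b κ_N·expJacSU(z_b) =ᵐ 1_{B̄_S}·κ_N^{#b}·e^{−Ψ}` (pub-balaban's a.e. swap `chartWeightSU_expJac_ae_eq`). [folklore] -/
theorem chartWeightSU_expJac_ae_eq_indicator_exp [NeZero N] (b : Finset (PBond P j)) {S : ℝ} (hS : S ≤ Real.pi) :
    chartWeightSU b S (expJacWeightSU (kappaSU N)) =ᵐ[volume]
      (closedBall (0 : BlockChartSU N b) S).indicator
        fun w => kappaSU N ^ b.card *
          ENNReal.ofReal (Real.exp (-∑ i, -Real.log (LinearMap.det (duhT (w i) : ChartSU N →ₗ[ℝ] ChartSU N)))) := by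
  filter_upwards [chartWeightSU_expJac_ae_eq (N := N) b S] with z hz
  rw [hz, chartWeightSU_jacM_eq_indicator_exp b hS z]

end Block

/-! ## §3  ★ File 10's `hdens` PRODUCED from a presentation of the dressed block weight on the window -/

section Dens

variable {N : ℕ} {P : Params} {j : ℕ}

/-- ★ **`hdens` FROM THE DRESSED PRESENTATION.**  If the dressed block weight read in the chart is, ON THE WINDOW `‖z‖ ≤ S`
(`0 ≤ S ≤ π`), the cut log-concave density `𝟙_{U<θ}∩C·𝟙_{K₀}·e^{−A}`, then the chart density of record
`chartWeightSU b S (expJacWeightSU κ_N)·R ∘ expFibreChartSU b c` is `volume`-a.e. `𝟙_{U<θ}∩C·𝟙_K·e^{−φ}` with `K = K₀ ∩ B̄_S` and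
`φ = A + Ψ − #b·log κ_N` — file 10's `hdens`, the Jacobian inside `φ`. [folklore] -/
theorem hdens_of_dressedPresentation [NeZero N] (b : Finset (PBond P j)) {S : ℝ} (hS : S ≤ Real.pi)
    (c : GaugeField P j (SUN N)) (R : (↥b → SUN N) → ℝ≥0∞) (U : BlockChartSU N b → ℝ) (C K₀ : Set (BlockChartSU N b))
    (A : BlockChartSU N b → ℝ) (θ : ℝ)
    (hR : ∀ z ∈ closedBall (0 : BlockChartSU N b) S, R (expFibreChartSU b c z) =
      ({z | U z < θ} ∩ C).indicator (fun z' => K₀.indicator (fun w => ENNReal.ofReal (Real.exp (-A w))) z') z) :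
    (fun z : BlockChartSU N b => chartWeightSU b S (expJacWeightSU (kappaSU N)) z * R (expFibreChartSU b c z))
      =ᵐ[volume] ({z | U z < θ} ∩ C).indicator fun z => (K₀ ∩ closedBall (0 : BlockChartSU N b) S).indicator
        (fun w => ENNReal.ofReal (Real.exp (-(A w +
          (∑ i, -Real.log (LinearMap.det (duhT (w i) : ChartSU N →ₗ[ℝ] ChartSU N))) -
            b.card * Real.log (kappaSU N).toReal)))) z := by
  have hκ : ENNReal.ofReal (kappaSU N).toReal = kappaSU N := ENNReal.ofReal_toReal kappaSU_ne_top
  have hκpos : 0 < (kappaSU N).toReal := ENNReal.toReal_pos kappaSU_ne_zero kappaSU_ne_top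
  have hκpow : kappaSU N ^ b.card = ENNReal.ofReal ((kappaSU N).toReal ^ b.card) := by
    rw [ENNReal.ofReal_pow hκpos.le, hκ]
  filter_upwards [chartWeightSU_expJac_ae_eq_indicator_exp (N := N) b hS] with z hz
  show chartWeightSU b S (expJacWeightSU (kappaSU N)) z * R (expFibreChartSU b c z) = _
  rw [hz]
  by_cases hzS : z ∈ closedBall (0 : BlockChartSU N b) S
  · rw [indicator_of_mem hzS, hR z hzS]
    by_cases hcut : z ∈ {z | U z < θ} ∩ C
    · rw [indicator_of_mem hcut, indicator_of_mem hcut]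
      by_cases hK : z ∈ K₀
      · rw [indicator_of_mem hK, indicator_of_mem (mem_inter hK hzS), hκpow,
          ← ENNReal.ofReal_mul (pow_nonneg hκpos.le _), ← ENNReal.ofReal_mul (by positivity)]
        congr 1
        rw [← Real.exp_log (pow_pos hκpos _), ← Real.exp_add, ← Real.exp_add, Real.log_pow]
        congr 1
        ring
      · have hK' : z ∉ K₀ ∩ closedBall (0 : BlockChartSU N b) S := fun h => hK h.1
        rw [indicator_of_notMem hK, indicator_of_notMem hK', mul_zero]
    · rw [indicator_of_notMem hcut, indicator_of_notMem hcut, mul_zero]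
  · rw [indicator_of_notMem hzS, zero_mul]
    by_cases hcut : z ∈ {z | U z < θ} ∩ C
    · rw [indicator_of_mem hcut]
      have hK' : z ∉ K₀ ∩ closedBall (0 : BlockChartSU N b) S := fun h => hzS h.2
      rw [indicator_of_notMem hK']
    · rw [indicator_of_notMem hcut]

end Dens

end Summit.QuantumFields.YangMills.Theorems.N21LowCentreEndAtSUNBlockChartJacobian

end
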